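import Summits.HubbardSuperconductivity.HubbardSuperconductivity.Theorems.KLProgrammeUVTadpoleInstantiation
import Summits.HubbardSuperconductivity.HubbardSuperconductivity.Theorems.KLProgrammeVanHoveShellLowerCount
import Summits.HubbardSuperconductivity.HubbardSuperconductivity.Theorems.KLProgrammeKLRegimeEngineScaleZeroE1Regime

/-!
# Route `KLProgramme`, crux K3 — ENGINE (stmt-HubbardSuperconductivity-20437 `KLRegimeEngineV17F2`), row (C) credit path, GAP **G-005**
# «(C)-TADPOLE-NONVANISHING»: THE REGIME ARITHMETIC — the UV Hartree sum is `≥ L²/128` on the engine regime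

Seat hubbard-kl-k3c5-p1 (g19; Matsubara supplier of G-005, pen (R433)(B)/(R434)(A): «owner's residual = reduction + arithmetic»; this is
the ARITHMETIC).  `…Theorems.MatsubaraTadpole.sum_uvTadpole_salmhofer_halfShift_ge` (p1b g18, ✓ p718875) bounds the UV Hartree sum
`S := Σ_{k⃗} β⁻¹Σᵢ χ₂((ωᵢ²+e_k²)/Λ₀²)·e_k/(ωᵢ²+e_k²)` (`e_k = ε_L(k⃗) − μ`) below by
`½·(N·(1 − 2e^{−βΛ₀}) − L²·(2(4−μ)β/(π²M) + e^{−β(−2μ−Λ₀−8π/L)}))`, `N = #{k⃗ : |ε_L(k⃗)| ≤ −μ−Λ₀−4π/L}`; `card_vanHoveShell_ge_of_le`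
(✓ p717073) gives `N ≥ L(2r+1)` for `2π(2r+1)/L ≤ −μ−Λ₀−4π/L`.  Here, at `Λ₀ := klE0 = 1/32` and on the ENGINE regime
(`klBetaMin ≤ β`, `μ ∈ klWindowC`, `klEngL₃ β U ≤ L`, `klEngM₃ β U L ≤ M`, via `scaleZero_regime_sizes`: `2¹⁵ ≤ L`, `β³ ≤ M`):
* §1 numerals: `exp_neg_four_le_inv_fifty` (`e⁻⁴ ≤ 1/50`), `exp_neg_le_inv_two_pow_32` (`32 ≤ x ⇒ e^{−x} ≤ 2⁻³²`);
* §2 **`uvTadpoleSum_ge_sq_div_128`** — `L²/128 ≤ S` (choice `r := L/108`: `2π(2r+1)/L ≤ 2π/54 + 2π/L ≤ 0.1184 ≤ −μ − 1/32 − 4π/L`;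
  `N ≥ L²/54 − L`; `1 − 2e^{−β/32} ≥ 24/25`; `2(4−μ)β/(π²M) ≤ 2·5.05/(9β²) ≤ 10⁻⁴`; `e^{−β(−2μ−1/32−8π/L)} ≤ e^{−32} ≤ 2⁻³²`;
  `(0.96(L²/54 − L) − L²/9000)/2 ≥ L²/128` for `L ≥ 470`), i.e. the first-order constant of the scale-`0` read is `≥ U/128` in size
  (float truth ≈ 0.043·U, p1b's table; the crude van Hove strip loses ×4.7).
With `…ScaleZeroTadpoleBridge.scaleZero_tadpole_re_ge_of_le` (this seat, p719208): `1/128 ≤ Re Σ_k (βL²)⁻²Ψ⁰(k,σ)` on the regime.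
Proofs only; no definitions; nothing here asserts G-005, (C), any stub of 20437, K3 or superconductivity.
References: BGM 2006 §2.1 (2.3)–(2.6), §2.3 [cite: BenfattoGiulianiMastropietro2006].
-/

noncomputable section

namespace Summit.HubbardSuperconductivity.HubbardSuperconductivity.Theorems.KLRegimeSplit

set_option linter.dupNamespace false -- summit = problem name (single-conjunct summit), D-0017

open Real Finset Literature.MathematicalPhysics.QuantumLattice Literature.Probability.LatticeModels
open Summit.HubbardSuperconductivity.HubbardSuperconductivity.Theorems.EngineV8
open Summit.HubbardSuperconductivity.HubbardSuperconductivity.Theorems.MatsubaraTadpole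

/-! ## §1 Numerals -/

/-- `e⁻⁴ ≤ 1/50` (`e > 2.718 ⇒ e⁴ > 54`). [folklore] -/
theorem exp_neg_four_le_inv_fifty : Real.exp (-4) ≤ 1 / 50 := by
  have h1 : (2.7182818283 : ℝ) < Real.exp 1 := Real.exp_one_gt_d9
  have h0 : 0 < Real.exp 1 := Real.exp_pos 1
  have h2 : (7 : ℝ) < Real.exp 1 ^ 2 := by nlinarith
  have h4 : (50 : ℝ) ≤ Real.exp 1 ^ 4 := by nlinarith
  have h4' : Real.exp 4 = Real.exp 1 ^ 4 := by rw [← Real.exp_nat_mul]; norm_num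
  rw [Real.exp_neg, inv_eq_one_div]
  exact one_div_le_one_div_of_le (by norm_num) (h4' ▸ h4)

/-- `32 ≤ x ⇒ e^{−x} ≤ 2⁻³²` (`e ≥ 2`). [folklore] -/
theorem exp_neg_le_inv_two_pow_32 {x : ℝ} (hx : 32 ≤ x) : Real.exp (-x) ≤ 1 / 2 ^ 32 := by
  have h2 : (2 : ℝ) ≤ Real.exp 1 := by have := Real.add_one_le_exp (1 : ℝ); norm_num at this; linarith
  have h32 : (2 : ℝ) ^ 32 ≤ Real.exp 32 := by
    have h : Real.exp 32 = Real.exp 1 ^ 32 := by rw [← Real.exp_nat_mul]; norm_num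
    rw [h]; exact pow_le_pow_left₀ (by norm_num) h2 32
  have hle : Real.exp (-x) ≤ Real.exp (-32) := Real.exp_le_exp.2 (by linarith)
  refine hle.trans ?_
  rw [Real.exp_neg, inv_eq_one_div]
  exact one_div_le_one_div_of_le (by norm_num) h32

/-! ## §2 The UV Hartree sum on the engine regime -/

section Regime

variable {L M : ℕ} [NeZero L] {β μ U : ℝ}

/-- **The arithmetic of the pairing bound** (no sum in sight): with `r := L/108`, on `128 ≤ β`, `μ ∈ [−1.05, −0.15]`, `2¹⁵ ≤ L`, `β³ ≤ M`,
`L²/128 ≤ ½·(#{|ε_L| ≤ −μ−klE0−4π/L}·(1 − 2e^{−β·klE0}) − L²·(2(4−μ)β/(π²M) + e^{−β(−2μ−klE0−8π/L)}))`. [cite: BenfattoGiulianiMastropietro2006, §2.1 (2.3)-(2.6)] -/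
theorem uvTadpole_pairingBound_ge_sq_div_128 (hβ128 : (128 : ℝ) ≤ β) (hμlo : (-1.05 : ℝ) ≤ μ) (hμhi : μ ≤ (-0.15 : ℝ))
    (hL15 : (2 : ℝ) ^ 15 ≤ L) (hβ3M : β ^ 3 ≤ (M : ℝ)) (hM0 : (0 : ℝ) < M) :
    (L : ℝ) ^ 2 / 128 ≤
      (((univ.filter fun k : TorusSite 2 L => |torusBand L k| ≤ -μ - klE0 - 4 * π / L).card : ℝ) * (1 - 2 * Real.exp (-(β * klE0))) -
        (L : ℝ) ^ 2 * (2 * ((4 - μ) * β / (π ^ 2 * M)) + Real.exp (-(β * (-2 * μ - klE0 - 2 * (4 * π / L)))))) / 2 := by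
  have hβ0 : 0 < β := by linarith
  have hπ3 : (3 : ℝ) < π := Real.pi_gt_three
  have hπ : π < 3.15 := Real.pi_lt_d2
  have hL15' : (32768 : ℝ) ≤ L :=
    calc (32768 : ℝ) = 2 ^ 15 := by norm_num
      _ ≤ L := hL15
  have hLpos : (0 : ℝ) < L := by linarith
  have hLnat : 32768 ≤ L := by exact_mod_cast hL15'
  have hE0 : klE0 = 1 / 32 := rfl
  have h4πL : 4 * π / (L : ℝ) ≤ 1 / 2500 := by rw [div_le_iff₀ hLpos]; nlinarith
  have h4πL0 : 0 ≤ 4 * π / (L : ℝ) := by positivity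
  -- the van Hove strip: `r := L/108`
  set r : ℕ := L / 108 with hr_def
  have hr : 2 * r + 1 ≤ L := by omega
  have hrlo : (L : ℝ) ≤ 108 * (r : ℝ) + 107 := by
    have h : L ≤ 108 * r + 107 := by omega
    exact_mod_cast h
  have hrhi : 108 * (r : ℝ) ≤ L := by
    have h : 108 * r ≤ L := by omega
    exact_mod_cast h
  have hη : 2 * π * (2 * r + 1) / L ≤ -μ - klE0 - 4 * π / L := by
    rw [hE0, div_le_iff₀ hLpos]
    have : (-μ - 1 / 32 - 4 * π / ↑L) * ↑L = (-μ - 1 / 32) * L - 4 * π := by field_simp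
    rw [this]
    nlinarith
  have hN := card_vanHoveShell_ge_of_le (L := L) r hr hη
  have hN0 : (L : ℝ) ^ 2 / 54 - L ≤ ((univ.filter fun k : TorusSite 2 L => |torusBand L k| ≤ -μ - klE0 - 4 * π / L).card : ℝ) := by
    have h1 : (L : ℝ) * ((L : ℝ) / 54 - 1) ≤ (L : ℝ) * (2 * r + 1) := by
      refine mul_le_mul_of_nonneg_left ?_ hLpos.le
      linarith
    have h2 : (L : ℝ) * ((L : ℝ) / 54 - 1) = (L : ℝ) ^ 2 / 54 - L := by ring
    linarith
  have hNnn : (0 : ℝ) ≤ ((univ.filter fun k : TorusSite 2 L => |torusBand L k| ≤ -μ - klE0 - 4 * π / L).card : ℝ) := Nat.cast_nonneg _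
  -- `A = 1 − 2e^{−β/32} ≥ 24/25`
  have hA : (24 : ℝ) / 25 ≤ 1 - 2 * Real.exp (-(β * klE0)) := by
    have h : Real.exp (-(β * klE0)) ≤ Real.exp (-4) := Real.exp_le_exp.2 (by rw [hE0]; linarith)
    linarith [exp_neg_four_le_inv_fifty]
  -- `B = 2(4−μ)β/(π²M) ≤ 10⁻⁴`
  have hB : 2 * ((4 - μ) * β / (π ^ 2 * M)) ≤ 1 / 10000 := by
    have hβM : β / (M : ℝ) ≤ 1 / 16384 := by
      rw [div_le_iff₀ hM0]
      have hβ2 : (16384 : ℝ) ≤ β ^ 2 := by nlinarith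
      have hβ3 : 16384 * β ≤ β ^ 3 := by nlinarith
      linarith
    have hπ2 : (9 : ℝ) ≤ π ^ 2 := by nlinarith
    have h1 : (4 - μ) * β / (π ^ 2 * M) = (4 - μ) / π ^ 2 * (β / M) := by
      field_simp
    rw [h1]
    have h2 : (4 - μ) / π ^ 2 ≤ 5.05 / 9 := by
      rw [div_le_div_iff₀ (by positivity) (by norm_num)]
      nlinarith
    have h3 : 0 ≤ (4 - μ) / π ^ 2 := div_nonneg (by linarith) (by positivity)
    have h4 : 0 ≤ β / (M : ℝ) := by positivity
    nlinarith
  -- `C = e^{−β(−2μ − 1/32 − 8π/L)} ≤ 2⁻³²`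
  have hC : Real.exp (-(β * (-2 * μ - klE0 - 2 * (4 * π / L)))) ≤ 1 / 10 ^ 9 := by
    refine (exp_neg_le_inv_two_pow_32 ?_).trans (by norm_num)
    rw [hE0]
    have h1 : (1 : ℝ) / 4 ≤ -2 * μ - 1 / 32 - 2 * (4 * π / ↑L) := by linarith
    calc (32 : ℝ) = 128 * (1 / 4) := by norm_num
      _ ≤ β * (-2 * μ - 1 / 32 - 2 * (4 * π / ↑L)) := mul_le_mul hβ128 h1 (by norm_num) hβ0.le
  -- combine (linear in the atoms `N·A`, `L²·B`, `L²·C`, `L²`, `L`)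
  have hNA : ((L : ℝ) ^ 2 / 54 - L) * (24 / 25) ≤
      ((univ.filter fun k : TorusSite 2 L => |torusBand L k| ≤ -μ - klE0 - 4 * π / L).card : ℝ) * (1 - 2 * Real.exp (-(β * klE0))) :=
    mul_le_mul hN0 hA (by norm_num) hNnn
  have hBC : (L : ℝ) ^ 2 * (2 * ((4 - μ) * β / (π ^ 2 * M)) + Real.exp (-(β * (-2 * μ - klE0 - 2 * (4 * π / L))))) ≤
      (L : ℝ) ^ 2 * (1 / 9000) :=
    mul_le_mul_of_nonneg_left (by linarith) (sq_nonneg _)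
  have hLL : 1000 * (L : ℝ) ≤ (L : ℝ) ^ 2 := by nlinarith
  linarith

/-- **THE UV HARTREE SUM IS `≥ L²/128` ON THE ENGINE REGIME** (`Λ₀ = klE0`): for `klBetaMin ≤ β`, `μ ∈ klWindowC`, `klEngL₃ β U ≤ L`, `klEngM₃ β U L ≤ M`,
`L²/128 ≤ Σ_{k⃗} β⁻¹Σᵢ χ₂((ωᵢ²+e_k²)/klE0²)·e_k/(ωᵢ²+e_k²)`. [cite: BenfattoGiulianiMastropietro2006, §2.1 (2.3)-(2.6)] -/
theorem uvTadpoleSum_ge_sq_div_128 (hβ : klBetaMin ≤ β) (hμ : μ ∈ klWindowC) (hL : klEngL₃ β U ≤ L) (hM : klEngM₃ β U L ≤ M) :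
    (L : ℝ) ^ 2 / 128 ≤ ∑ kv : TorusSite 2 L, β⁻¹ * ∑ i : MatsubaraIdx M,
      salmhoferCutoff ((matsubaraFreq β M i ^ 2 + (torusBand L kv - μ) ^ 2) / klE0 ^ 2) *
        ((torusBand L kv - μ) / (matsubaraFreq β M i ^ 2 + (torusBand L kv - μ) ^ 2)) := by
  obtain ⟨hL15, -, hM2, -, hβ3M, -⟩ := scaleZero_regime_sizes (U := U) hβ hL hM
  have hβ128 : (128 : ℝ) ≤ β := by simpa [klBetaMin] using hβ
  have hβ0 : 0 < β := by linarith
  have hμ' : μ ∈ Set.Icc (-1.05 : ℝ) (-0.15) := by simpa only [klWindowC] using hμ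
  obtain ⟨hμlo, hμhi⟩ := hμ'
  have hπ : π < 3.15 := Real.pi_lt_d2
  have hLpos : (0 : ℝ) < L := by linarith
  have hM1 : 1 ≤ M := by omega
  have hM0 : (0 : ℝ) < M := by exact_mod_cast (show 0 < M by omega)
  have hE0 : klE0 = 1 / 32 := rfl
  have h4πL : 4 * π / (L : ℝ) ≤ 1 / 2500 := by rw [div_le_iff₀ hLpos]; nlinarith
  have hμE : klE0 + 4 * π / L ≤ -μ := by rw [hE0]; linarith
  exact (uvTadpole_pairingBound_ge_sq_div_128 (M := M) hβ128 hμlo hμhi hL15 hβ3M hM0).trans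
    (sum_uvTadpole_salmhofer_halfShift_ge (L := L) (M := M) (β := β) (μ := μ) hβ0 hM1 (by rw [hE0]; norm_num) hμE)

end Regime

end Summit.HubbardSuperconductivity.HubbardSuperconductivity.Theorems.KLRegimeSplit

end
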